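import Summits.QuantumFields.GaugeBoot.ZdCentralTwist
import Summits.QuantumFields.GaugeBoot.CubicTorusLinkRPAnyBeta
import HarnessLib

/-!
# The `ℤ^d` staggered central twist on torus limit points: even-side limit points at `β` and
# at `-β` correspond (gauge-boot, L3 structural supplement; `ℤ^d` twist 4/4)

HONEST FRAMING (cell `pub-gaugeboot`, page 1 of every file): the venture produces certified bounds
on lattice expectations at stated coupling, gauge group, dimension and torus size; NOT a mass gap,
NOT a continuum limit, NOT a string tension; NOT Yang–Mills-summit-bearing (barriers
`FixedCouplingUltralocality`, `PerturbativeInvisibility`). This module bounds no expectation; no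
certificate of the cell sits at `β < 0`. It concerns the class "LIMIT" of the cell's table
(infinite-volume limit points of EVEN-side torus Wilson states, `IsInfiniteVolumeLimitAlong`) only
structurally: it identifies that class at `-β` with the twist of the class at `β`.

Parts 1–3 (`ZdCentralTwist`, `ZdCentralTwistSymmetries`, `ZdCentralTwistStates`): the twist
`T = centralTwist (stagTwist π r z)` of `ℤ^d` configurations (`ρ z = -1`, `z` central, `z² = 1`).
`CubicTorusLinkRPAnyBeta.lean`: on the EVEN torus `(ℤ/L)^d` the same Kogut–Susskind twist `T_L`
(parities `x_m mod 2`, well defined because `2 ∣ L`) maps the Wilson measure at `β` onto the one at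
`-β` (`cubicTorus_integral_comp_stagTwist`). Here the two are tied by the periodic lift:

* `stagParity_torusProj`, ★ `torusLift_centralTwist_stagTwist` — `lift ∘ T_L = T ∘ lift` (`2 ∣ L`);
  `toTorusObservable_comp_centralTwist` — `(F ∘ T)` read on the torus is `(F on the torus) ∘ T_L`;
* ★ `wilsonExpectation_toTorusObservable_comp_centralTwist` — `⟨(F ∘ T)∘lift⟩_{L,β} = ⟨F∘lift⟩_{L,-β}`
  for every `F` on `ℤ^d` configurations and every even `L`;
* ★★★ `IsInfiniteVolumeLimitAlong.map_centralTwist` — **if `μ` is the infinite-volume limit of the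
  torus Wilson states at `β` along a sequence of EVEN sides, then the twisted state `μ ∘ T⁻¹` is the
  infinite-volume limit at `-β` along the SAME sequence**; `isInfiniteVolumeLimitAlong_map_centralTwist_iff`
  (it is a bijection, `T` being an involution); `map_centralTwist_mem_infiniteVolumeLimitPoints`;
* `integral_plaquetteObs_map_centralTwist` — the plaquette expectation of the twisted state is the
  negative of the original one (any probability measure), so along even sides the limit-point
  plaquette values at `-β` are exactly the negatives of those at `β` — the infinite-volume form of
  `plaquetteExpectation_neg_of_even`.

With part 1 (`IsHaarShiftState.map_centralTwist`, `isZdTranslationInvariant_map_centralTwist`) and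
part 3 this says: for `SU(2)`, `SU(2n)`, `U(N)` every structural property the cell records for
even-side limit points at `β > 0` has an exact mirror at `-β`, EXCEPT full (gauge-variant) diagonal
reflection positivity. What is NOT claimed: nothing about odd sides (no twist: `(ℤ/L)^d` with `L`
odd carries no mod-2 parity), nothing for `SU(2n+1)`, no bound on any expectation. [folklore]
bookkeeping (Li–Meurice, Phys. Rev. D 71 (2005) 016008 §II; Seiler, LNP 159 (1982) Ch. 2).
-/

noncomputable section

open MeasureTheory Filter Topology
open Literature.Probability.LatticeModels (Site Torus.proj)
open Literature.MathematicalPhysics.QuantumLattice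
open Literature.MathematicalPhysics.QuantumFieldTheory (GaugeConfig wilsonMeasure wilsonExpectation
  isProbabilityMeasure_wilsonMeasure)

namespace Summit.QuantumFields.GaugeBoot

namespace TiltedRP

variable {d L N : ℕ} {G : Type} [Group G]

/-! ## The periodic lift intertwines the torus twist and the `ℤ^d` twist (even side) -/

section Lift

variable {z : G} {π : Fin d → Site d →+ ZMod 2}

/-- The staggered parities of a `ℤ^d` link and of its projection to the even torus agree. -/
theorem stagParity_torusProj (hπ : IsDualParity (zdUnit d) π) (h2 : 2 ∣ L) (r : Fin d) (x : Site d)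
    (m : Fin d) :
    stagParity (cubicParity d L h2) r (Torus.proj L x, m) = stagParity π r (x, m) := by
  unfold stagParity
  refine Finset.sum_congr rfl fun k _ => ?_
  rw [hπ.apply_zd]
  simp [Torus.proj]

/-- The staggered weights of a `ℤ^d` link and of its projection agree. -/
theorem stagTwist_torusEdge (hπ : IsDualParity (zdUnit d) π) (h2 : 2 ∣ L) (r : Fin d) (z : G)
    (e : ZdEdge d) :
    stagTwist (cubicParity d L h2) r z (torusEdge L e) = stagTwist π r z e := by
  obtain ⟨x, m⟩ := e
  unfold stagTwist
  rw [show torusEdge L (x, m) = (Torus.proj L x, m) from rfl, stagParity_torusProj hπ h2]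

/-- ★ **The periodic lift intertwines the twists**: `lift (T_L U) = T (lift U)` for even `L`. -/
theorem torusLift_centralTwist_stagTwist (hπ : IsDualParity (zdUnit d) π) (h2 : 2 ∣ L) (r : Fin d)
    (z : G) (U : GaugeConfig d L G) :
    torusLift L (centralTwist (stagTwist (cubicParity d L h2) r z) U) =
      centralTwist (stagTwist π r z) (torusLift L U) := by
  funext e
  simp only [torusLift, Function.comp_apply, centralTwist_apply, stagTwist_torusEdge hπ h2]

/-- `(F ∘ T)` transported to the torus is the transported `F` composed with the torus twist. -/
theorem toTorusObservable_comp_centralTwist (hπ : IsDualParity (zdUnit d) π) (h2 : 2 ∣ L)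
    (r : Fin d) (z : G) {α : Type*} (F : LGConfig d G → α) :
    toTorusObservable L (F ∘ centralTwist (stagTwist π r z)) =
      toTorusObservable L F ∘ centralTwist (stagTwist (cubicParity d L h2) r z) := by
  funext U
  simp only [toTorusObservable, Function.comp_apply, torusLift_centralTwist_stagTwist hπ h2]

variable [TopologicalSpace G] [IsTopologicalGroup G] [CompactSpace G] [MeasurableSpace G]
  [BorelSpace G] [SecondCountableTopology G]
variable (ρ : G →* Matrix (Fin N) (Fin N) ℂ)

/-- ★ **Torus expectations: `⟨(F ∘ T) ∘ lift⟩_{L, β} = ⟨F ∘ lift⟩_{L, -β}`** for every observable `F`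
of `ℤ^d` configurations, every EVEN side `L` and every real `β` (`ρ z = -1`). -/
theorem wilsonExpectation_toTorusObservable_comp_centralTwist [NeZero L]
    (hπ : IsDualParity (zdUnit d) π) (h2 : 2 ∣ L) (r : Fin d) (hρ : Continuous ρ)
    (hzc : ∀ g : G, z * g = g * z) (hz2 : z * z = 1) (hρz : ρ z = -1) (β : ℝ)
    {V : Type*} [NormedAddCommGroup V] [NormedSpace ℝ V] (F : LGConfig d G → V) :
    wilsonExpectation (L := L) ρ β (toTorusObservable L (F ∘ centralTwist (stagTwist π r z))) =
      wilsonExpectation (L := L) ρ (-β) (toTorusObservable L F) := by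
  rw [toTorusObservable_comp_centralTwist hπ h2 r z]
  exact cubicTorus_integral_comp_stagTwist ρ h2 r hρ hzc hz2 hρz β (toTorusObservable L F)

end Lift

/-! ## Even-side limit points at `β` and at `-β` -/

section Limits

variable [TopologicalSpace G] [IsTopologicalGroup G] [CompactSpace G] [MeasurableSpace G]
  [BorelSpace G] [SecondCountableTopology G]
variable (ρ : G →* Matrix (Fin N) (Fin N) ℂ) {z : G} {π : Fin d → Site d →+ ZMod 2}

/-- ★★★ **The twist carries even-side infinite-volume limits at `β` to even-side infinite-volume
limits at `-β`, along the same sequence of sides.** If `μ` is the limit of the torus Wilson states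
`μ_{(ℤ/(L_k+1))^d, β}` on bounded continuous cylinder observables, and every side `L_k + 1` is
even, then `μ ∘ T⁻¹` is the limit of `μ_{(ℤ/(L_k+1))^d, -β}` (`ρ` continuous with `ρ z = -1`). -/
theorem _root_.Literature.MathematicalPhysics.QuantumLattice.IsInfiniteVolumeLimitAlong.map_centralTwist
    (hπ : IsDualParity (zdUnit d) π) (r : Fin d) (hρ : Continuous ρ)
    (hzc : ∀ g : G, z * g = g * z) (hz2 : z * z = 1) (hρz : ρ z = -1) {β : ℝ} {Lk : ℕ → ℕ}
    (heven : ∀ k, 2 ∣ Lk k + 1) {μ : Measure (LGConfig d G)}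
    (hμ : IsInfiniteVolumeLimitAlong ρ β Lk μ) :
    IsInfiniteVolumeLimitAlong ρ (-β) Lk (μ.map (centralTwist (stagTwist π r z))) := by
  haveI := hμ.1
  refine ⟨isProbabilityMeasure_map_centralTwist _ μ, fun F S hFS hFc hFb => ?_⟩
  rw [integral_map_centralTwist _ μ hFc]
  have hT : Continuous (centralTwist (stagTwist π r z) : LGConfig d G → LGConfig d G) :=
    continuous_centralTwist _
  have h := hμ.2 (F ∘ centralTwist (stagTwist π r z)) S (isCylinder_comp_centralTwist _ hFS)
    (hFc.comp hT) (hFb.imp fun C hC U => hC _)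
  refine h.congr' (Eventually.of_forall fun k => ?_)
  exact wilsonExpectation_toTorusObservable_comp_centralTwist ρ hπ (heven k) r hρ hzc hz2 hρz β F

/-- ★★ **`β ↦ -β` is a bijection of even-side limit points**: `μ ∘ T⁻¹` is an even-side limit at `β`
iff `μ` is one at `-β`. -/
theorem isInfiniteVolumeLimitAlong_map_centralTwist_iff (hπ : IsDualParity (zdUnit d) π)
    (r : Fin d) (hρ : Continuous ρ) (hzc : ∀ g : G, z * g = g * z) (hz2 : z * z = 1)
    (hρz : ρ z = -1) (β : ℝ) {Lk : ℕ → ℕ} (heven : ∀ k, 2 ∣ Lk k + 1) (μ : Measure (LGConfig d G)) :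
    IsInfiniteVolumeLimitAlong ρ β Lk (μ.map (centralTwist (stagTwist π r z))) ↔
      IsInfiniteVolumeLimitAlong ρ (-β) Lk μ := by
  have hs := isStaggering_stagTwist (G := G) (e := zdUnit d) hπ r hzc hz2
  refine ⟨fun h => ?_, fun h => by simpa using h.map_centralTwist ρ hπ r hρ hzc hz2 hρz heven⟩
  have h' := h.map_centralTwist ρ hπ r hρ hzc hz2 hρz heven
  rwa [← eq_map_centralTwist_map_centralTwist hs μ] at h'

/-- ★★ **The twist of an even-side limit point at `β` is a limit point at `-β`.** -/
theorem map_centralTwist_mem_infiniteVolumeLimitPoints (hπ : IsDualParity (zdUnit d) π)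
    (r : Fin d) (hρ : Continuous ρ) (hzc : ∀ g : G, z * g = g * z) (hz2 : z * z = 1)
    (hρz : ρ z = -1) {β : ℝ} {Lk : ℕ → ℕ} (hmono : StrictMono Lk) (heven : ∀ k, 2 ∣ Lk k + 1)
    {μ : Measure (LGConfig d G)} (hμ : IsInfiniteVolumeLimitAlong ρ β Lk μ) :
    μ.map (centralTwist (stagTwist π r z)) ∈ infiniteVolumeLimitPoints (d := d) ρ (-β) :=
  ⟨Lk, hmono, hμ.map_centralTwist ρ hπ r hρ hzc hz2 hρz heven⟩

omit [CompactSpace G] in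
/-- **The plaquette expectation of a twisted state is the negative of the original one**
(every measure; `ρ` continuous with `ρ z = -1`, `i ≠ j`). -/
theorem integral_plaquetteObs_map_centralTwist {s : ZdEdge d → G}
    (hs : IsStaggering (zdUnit d) z s) (hρ : Continuous ρ) (hρz : ρ z = -1)
    (μ : Measure (LGConfig d G)) (x : Site d) {i j : Fin d} (hij : i ≠ j) :
    ∫ U, plaquetteObs ρ x i j U ∂(μ.map (centralTwist s)) = -∫ U, plaquetteObs ρ x i j U ∂μ := by
  rw [integral_map_centralTwist s μ (continuous_plaquetteObs ρ hρ x i j), ← integral_neg]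
  exact integral_congr_ae (ae_of_all _ fun U => hs.plaquetteObs_centralTwist ρ hρz x hij U)

/-- ★ **Even-side limit-point plaquette values at `-β` are the negatives of those at `β`**: if `μ`
is an even-side limit at `β` then `μ ∘ T⁻¹` is one at `-β` with `∫ u_p d(μ ∘ T⁻¹) = -∫ u_p dμ`
(the infinite-volume form of `plaquetteExpectation_neg_of_even`). -/
theorem exists_limit_neg_integral_plaquetteObs (hπ : IsDualParity (zdUnit d) π) (r : Fin d)
    (hρ : Continuous ρ) (hzc : ∀ g : G, z * g = g * z) (hz2 : z * z = 1) (hρz : ρ z = -1)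
    {β : ℝ} {Lk : ℕ → ℕ} (heven : ∀ k, 2 ∣ Lk k + 1) {μ : Measure (LGConfig d G)}
    (hμ : IsInfiniteVolumeLimitAlong ρ β Lk μ) (x : Site d) {i j : Fin d} (hij : i ≠ j) :
    ∃ ν : Measure (LGConfig d G), IsInfiniteVolumeLimitAlong ρ (-β) Lk ν ∧
      ∫ U, plaquetteObs ρ x i j U ∂ν = -∫ U, plaquetteObs ρ x i j U ∂μ :=
  ⟨_, hμ.map_centralTwist ρ hπ r hρ hzc hz2 hρz heven,
    integral_plaquetteObs_map_centralTwist ρ (isStaggering_stagTwist hπ r hzc hz2) hρ hρz μ x hij⟩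

end Limits

/-! ## The venture's gauge groups -/

section Groups

open Literature.MathematicalPhysics.QuantumLattice (fundamentalRep unitaryFundamentalRep
  continuous_fundamentalRep continuous_unitaryFundamentalRep)

/-- ★★★ **`SU(M)`, `M` even (so `SU(2)`): even-side limit points at `β_tree` and `-β_tree` correspond
under the twist by `z = -1`**, every dimension `d`, every real `β`. -/
theorem isInfiniteVolumeLimitAlong_neg_iff_suEven {M : ℕ} (hM : Even M) [NeZero M] {d : ℕ}
    {π : Fin d → Site d →+ ZMod 2} (hπ : IsDualParity (zdUnit d) π) (r : Fin d) (β : ℝ)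
    {Lk : ℕ → ℕ} (heven : ∀ k, 2 ∣ Lk k + 1)
    (μ : Measure (LGConfig d (Matrix.specialUnitaryGroup (Fin M) ℂ))) :
    IsInfiniteVolumeLimitAlong (fundamentalRep (Fin M)) β Lk
        (μ.map (centralTwist (stagTwist π r
          (⟨-1, neg_one_mem_specialUnitaryGroup_of_even hM⟩ : Matrix.specialUnitaryGroup (Fin M) ℂ)))) ↔
      IsInfiniteVolumeLimitAlong (fundamentalRep (Fin M)) (-β) Lk μ := by
  refine isInfiniteVolumeLimitAlong_map_centralTwist_iff (fundamentalRep (Fin M)) hπ r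
    (continuous_fundamentalRep (Fin M)) (fun g => ?_) ?_ ?_ β heven μ
  · exact Subtype.ext (by simp)
  · exact Subtype.ext (by simp)
  · rw [fundamentalRep_apply]

/-- ★★★ **`U(N)`, `N ≥ 1`: even-side limit points at `β` and `-β` correspond under the twist by
`z = -1`**, every dimension `d`, every real `β`. -/
theorem isInfiniteVolumeLimitAlong_neg_iff_uN {N d : ℕ} {π : Fin d → Site d →+ ZMod 2}
    (hπ : IsDualParity (zdUnit d) π) (r : Fin d) (β : ℝ) {Lk : ℕ → ℕ} (heven : ∀ k, 2 ∣ Lk k + 1)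
    (μ : Measure (LGConfig d (Matrix.unitaryGroup (Fin N) ℂ))) :
    IsInfiniteVolumeLimitAlong (unitaryFundamentalRep (Fin N) ℂ) β Lk
        (μ.map (centralTwist (stagTwist π r
          (⟨-1, by simp [Matrix.mem_unitaryGroup_iff]⟩ : Matrix.unitaryGroup (Fin N) ℂ)))) ↔
      IsInfiniteVolumeLimitAlong (unitaryFundamentalRep (Fin N) ℂ) (-β) Lk μ := by
  refine isInfiniteVolumeLimitAlong_map_centralTwist_iff (unitaryFundamentalRep (Fin N) ℂ) hπ r
    (continuous_unitaryFundamentalRep (Fin N) ℂ) (fun g => ?_) ?_ ?_ β heven μ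
  · exact Subtype.ext (by simp)
  · exact Subtype.ext (by simp)
  · rfl

end Groups

end TiltedRP

end Summit.QuantumFields.GaugeBoot
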